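import Summits.QuantumFields.QCD.Theses.HeatSlicedQuarks

/-!
# Sketch (crux-ideate k = 2) — crux `ActionBoundsLowModes` (stmt-QuantumFields-8872)

First lemma of the idea card `kinetic-orthonormal-rumin`: the Rumin–Frank quadratic trace
inequality for the (massive) gauge-covariant bundle Laplacian on the 4-torus, and the counting
junction it feeds (kinetic-orthonormal Gram–Schmidt + Cauchy–Schwarz), which together with the
route support `WilsonLichnerowicz` (8874) closes the crux.  Statements only (Props); nothing is
asserted.  Source of the engine: R. L. Frank, *Cwikel's theorem and the CLR inequality*,
J. Spectr. Theory 4 (2014) 1–21 (arXiv:1206.3325), Theorem 3.2 + Lemma 3.4 and the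
"impatient reader's" derivation of CLR on p. 4, specialised to `ν = 4`, `X` = sites × colours ×
spins with counting measure, `𝓗 = ℂ`.
-/

open Literature.MathematicalPhysics.QuantumLattice Literature.MathematicalPhysics.QuantumFieldTheory
open Literature.Probability.LatticeModels (TorusSite)
open scoped ComplexOrder

noncomputable section

namespace Summit.QuantumFields.QCD.Cruxes.ActionBoundsLowModes.SketchK2

local notation "SU3" => Matrix.specialUnitaryGroup (Fin 3) ℂ
local notation "ρ₃" => fundamentalRep (Fin 3)

/-- The quark-field index of the crux: site × colour × spin. -/
abbrev Idx (L : ℕ) : Type := TorusSite 4 L × Fin 3 × Fin 4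

/-- The (positive) gauge-covariant bundle Laplacian `K_U = Σ_μ ∇_μ† ∇_μ` on quark fields
(spin-blind: `K_U ⊗ 1₄`), i.e. `(K_U v)(x) = Σ_μ [2 v(x) − U(x,μ) v(x+μ̂) − U(x−μ̂,μ)⁻¹ v(x−μ̂)]`,
same link orientation as the tree's `wilsonDirac` / `covariantLaplacian` (whose Wilson term is
`+½ K_U` at `r = 1`): `Re D_W = m + ½ K_U` (route support `AccretiveWilsonDirac`). -/
def bundleLap {L : ℕ} (U : GaugeConfig 4 L SU3) : Matrix (Idx L) (Idx L) ℂ :=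
  Matrix.of fun p q =>
    (if p = q then (8 : ℂ) else 0) -
      (∑ μ : Fin 4,
        ((if q.1 = Literature.MathematicalPhysics.QuantumFieldTheory.Site.shift p.1 μ then (ρ₃ (U (p.1, μ))) p.2.1 q.2.1 else 0) +
          (if p.1 = Literature.MathematicalPhysics.QuantumFieldTheory.Site.shift q.1 μ then (ρ₃ (U (q.1, μ))⁻¹) p.2.1 q.2.1
            else 0))) * (if p.2.2 = q.2.2 then 1 else 0)

/-- The massive kinetic operator of the line: `T_U := K_U + L⁻²` (the `κ = L⁻²` shift kills the
torus zero mode; it is what the crux's `+ 1` pays for, cf. Disproof `not_withoutOne`).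
Positive definite, `T_U ≥ L⁻²`. -/
def kinetic (L : ℕ) (U : GaugeConfig 4 L SU3) : Matrix (Idx L) (Idx L) ℂ :=
  bundleLap U + ((1 : ℂ) / ((L : ℂ) ^ 2)) • (1 : Matrix (Idx L) (Idx L) ℂ)

/-- **First lemma (Rumin–Frank quadratic trace inequality on the dominated bundle).**
There is an absolute `K' > 0` such that for every torus side `L`, every `SU(3)` lattice gauge
field `U` and every positive semidefinite `γ` with `γ ≤ T_U⁻¹` ("kinetic sub-unit density"),
`Re tr(T_U γ) ≥ K' · Σ_i (γ_ii)²`, the sum running over ALL indices `i = (x, a, α)`.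
Frank 2014 Thm 3.2/Lemma 3.4 with `ν = 4` (so `ν/(ν−2) = 2`: the Rumin functional is
quadratic), scalar fibre; the only input about `U` is the diagonal bound
`(E² T_U⁻¹ (T_U + E)⁻²)_ii ≤ A·E` for all `E > 0`, which follows entrywise from the Neumann-series
domination of resolvent powers of `K_U = 8 − Hop_U` by those of the free Laplacian (closed walks
carry unitary holonomies, `‖Σ hol‖ ≤ #walks`) and the free torus Fourier sum. -/
def RuminFrankBundleTrace : Prop :=
  ∃ K' : ℝ, 0 < K' ∧ ∀ (L : ℕ) [NeZero L] (U : GaugeConfig 4 L SU3) (γ : Matrix (Idx L) (Idx L) ℂ),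
    γ.PosSemidef → ((kinetic L U)⁻¹ - γ).PosSemidef →
      K' * ∑ i : Idx L, (γ i i).re ^ 2 ≤ ((kinetic L U) * γ).trace.re

/-- **The diagonal resolvent bound that feeds it** (Frank's hypothesis (3.2) in soft form, `ν = 4`):
an absolute `A` with `(E² · T_U⁻¹ (T_U + E)⁻²)_ii ≤ A · E` for every `L, U, E > 0` and every index
`i` — uniform in the gauge field by holonomy-blind domination of the positive Neumann series
`(T_U + E)⁻¹ = Σ_n Hop_Uⁿ / (8 + L⁻² + E)^{n+1}`, and finite on the torus thanks to the `L⁻²`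
shift (zero-mode term `≤ E/4`). -/
def DiagonalResolventBound : Prop :=
  ∃ A : ℝ, ∀ (L : ℕ) [NeZero L] (U : GaugeConfig 4 L SU3) (E : ℝ), 0 < E → ∀ i : Idx L,
    (((E : ℂ) ^ 2 • ((kinetic L U)⁻¹ *
        ((kinetic L U + (E : ℂ) • (1 : Matrix (Idx L) (Idx L) ℂ))⁻¹ *
          (kinetic L U + (E : ℂ) • (1 : Matrix (Idx L) (Idx L) ℂ))⁻¹))) i i).re ≤ A * E

/-- **Junction (kinetic-orthonormal count = bundle CLR for an arbitrary site potential).**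
For every non-negative site function `W` and every subspace `E` of quark fields on which the
kinetic form is dominated by the potential, `⟨v, T_U v⟩ ≤ Σ_i W(site i) |v_i|²`, one has
`finrank E ≤ C · Σ_x W(x)²`.  Derivation from `RuminFrankBundleTrace` (Frank 2014 p. 4):
take a `T_U`-orthonormal basis `ψ₁ … ψ_N` of `E` (Gram–Schmidt in the inner product
`⟨T_U^{1/2}·, T_U^{1/2}·⟩`, possible since `T_U > 0`), `γ := Σ_j |ψ_j⟩⟨ψ_j|`; then `γ ≤ T_U⁻¹`,
`tr T_U γ = N`, and `tr (T_U − W) γ ≤ 0` termwise, so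
`N ≤ Σ_i W_i γ_ii ≤ ‖W‖_{ℓ²(Idx)} ‖diag γ‖_{ℓ²(Idx)} ≤ (12 Σ_x W(x)²)^{1/2} (N/K')^{1/2}`,
i.e. `N ≤ 12 Σ_x W(x)² / K'` — two Cauchy–Schwarz inequalities, no min–max. -/
def KineticOrthonormalCount : Prop :=
  ∃ C : ℝ, ∀ (L : ℕ) [NeZero L] (U : GaugeConfig 4 L SU3) (W : TorusSite 4 L → ℝ),
    (∀ x, 0 ≤ W x) → ∀ (E : Submodule ℂ (Idx L → ℂ)),
      (∀ v ∈ E, (star v ⬝ᵥ ((kinetic L U).mulVec v)).re ≤ ∑ i : Idx L, W i.1 * ‖v i‖ ^ 2) →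
        (Module.finrank ℂ E : ℝ) ≤ C * ∑ x : TorusSite 4 L, W x ^ 2

/-- How the line closes the crux (recorded as a `Prop`, to be proved by the line's skeleton):
`WilsonLichnerowicz` (route support 8874: `½ K_U ≤ D_W†D_W + C·V_U` on `m ∈ [−½, 1]`, with
`Σ_x V_U(x)² ≤ C' S_W(U)`) puts the crux subspace `E` (where `‖D_W v‖² ≤ λ‖v‖²`) inside the
hypothesis of `KineticOrthonormalCount` with `W := 2(C·V_U + λ + L⁻²)`, and
`Σ_x W² ≤ 24(C² C' S_W + λ² L⁴ + 1)`. -/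
def JunctionClosesCrux : Prop :=
  KineticOrthonormalCount → Theses.HeatSlicedQuarks.WilsonLichnerowicz →
    Theses.HeatSlicedQuarks.ActionBoundsLowModes

/-- And the engine feeds the junction. -/
def EngineFeedsJunction : Prop :=
  DiagonalResolventBound → RuminFrankBundleTrace ∧ (RuminFrankBundleTrace → KineticOrthonormalCount)

end Summit.QuantumFields.QCD.Cruxes.ActionBoundsLowModes.SketchK2

end
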